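import Summits.ValiantsHypothesis.ValiantsHypothesis.Theorems.LacunarySymmetroidMatrixDescartesDoorA26WallBubblingBubblingExtendedCount
import Literature.Analysis.TotalPositivity.LaguerreLaplaceRuleOfSigns

/-!
# Wall bubbling for `DoorA26` — the LAGUERRE–PÓLYA COUNT WITH MULTIPLICITY; the confluent `(2,6)` determinant: generic bound `20`, and `≤ 19` OFF the 2-Sidon locus of its exponents

LINE / STUBS.  Crux `Theses.LacunarySymmetroid.DoorA26` (stmt-ValiantsHypothesis-19979; OPEN, typed, never asserted), line
`Cruxes/DoorA26/Lines/wall_bubbling.lean` (val-idea-15), obligation (W).  The line lead's statement file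
`Cruxes/DoorA26/Lines/wall_bubbling_ConfluentDoor.lean` (rev 3) types the CONFLUENT DOOR `ConfluentDoor26` (LOG-currency, WITH multiplicity): for
injective `e : Fin 5 → ℝ` and symmetric `τ, T, S_k`, if `F(t) = det(e^{e₀t}(τ + t·T) + Σ_k e^{e_{k+1}t} S_k)` is not identically zero then its
real zeros counted with multiplicity (orders certified through `iteratedDeriv`) number `≤ 19` — one less than the generic extended count
`Σ(deg+1) − 1 = 21 − 1 = 20`; W2's door step (`…WallBubblingConfluentTower.no_twenty_window_of_confluentDoor`, p653192) consumes exactly that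
conclusion.  This file supplies (def-free; the determinant written inline exactly as in `ConfluentDoor26` / `…ConfluentTower`):

* `extSum_zerosWithMultiplicity_le` — **LAGUERRE–PÓLYA COUNT WITH MULTIPLICITY** for extended real exponential sums `Σ_w P_w(t)e^{wt}`:
  some `P_w ≠ 0` and `Σ_w [P_w ≠ 0](deg P_w + 1) ≤ N + 1` ⇒ at most `N` real zeros COUNTED WITH MULTIPLICITY, in the tree's currency
  `Literature…LaguerreRuleOfSigns.ZerosWithMultiplicityLE` (Pólya–Szegő V §1); proof = W4's `extSum_card_zeros_le` (p646545, distinct zeros)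
  re-run with `ZerosWithMultiplicityLE.of_mul` (twist by `e^{−w₁t}`) and `ZerosWithMultiplicityLE.of_deriv` (Rolle WITH multiplicity,
  Pólya–Szegő V.12) in place of the finite-set Rolle count — the «count WITH multiplicity at the limit» named in the (W) register (R2694 (A));
* `confluentDet_extSum`, `confluentDet_slots_le`, `card_pairSums_five` — the confluent determinant IS such a sum over the set `F` of pair sums of
  `e`, `Σ slots ≤ |F| + 6`, `|F| ≤ 15`, `|F| ≤ 14` under a coincidence; `confluentDet_zerosWithMultiplicity_le_twenty` — the GENERIC bound `20`
  WITH MULTIPLICITY (no hypothesis on `e`) — the number the door lowers by one;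
* `confluentDet_zerosWithMultiplicity_le_nineteen_of_coincidence` / `confluentDoor_conclusion_of_coincidence` — if `e` is NOT 2-Sidon
  (`e_a + e_b = e_c + e_d` for two distinct canonical pairs) and `F ≢ 0` then `Σ_{z∈Z} m z ≤ 19`: literally the conclusion of `ConfluentDoor26`,
  so **the door's content lives on the 2-Sidon exponent vectors** (the analogue, one level up, of `Census.RealExp.realRow_two_six_of_pairSum_eq`:
  the genuine door `DoorA26` is automatic at a pair-sum coincidence).

HONEST LIMITS (line lead 2026-08-28T18:08Z, ACCEPTED by this seat).  The last item is NOT an exit for `Stmt.weylFaces_wall`: at a Weyl ∩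
disjoint-wall point the third-level LIMIT OBJECT of an accumulation of twenties is not the confluent determinant with exponents ON the wall —
the two member exponentials merging into the coincident class keep TWO slots `e^{Et}, t·e^{Et}` in W2's tower currency (Vandermonde), so the
slot total stays `21` and the extended count stays `20` unless the ANATOMY forces a limit slot coefficient to vanish (OPEN).  Nothing here bears on
(W)/(M)/(R) themselves, on `DoorA26`, on `MatrixDescartes` (stmt-ValiantsHypothesis-18050) or on `VP ≠ VNP`; registers unchanged.

Seat val-sym-door-p2 g12 (W1 #12), `--supports stmt-ValiantsHypothesis-19979 --as helper`. [folklore: Laguerre 1898; Pólya–Szegő 1976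
Part V §1, Probl. 12, §75] [this work] the slot bookkeeping of the confluent `(2,6)` determinant.
-/

-- `Summit.ValiantsHypothesis.ValiantsHypothesis.…` repeats a component by the D-0017 layout
-- (single-conjunct summit), which the `dupNamespace` linter flags; the name is mandated.
set_option linter.dupNamespace false

namespace Summit.ValiantsHypothesis.ValiantsHypothesis.Theorems.LacunarySymmetroidMatrixDescartes.WallBubbling.Bubbling

open Finset Filter Topology Polynomial
open Literature.Analysis.TotalPositivity.LaguerreRuleOfSigns (ZerosWithMultiplicityLE zerosWithMultiplicityLE_of_ne_zero)

/-! ## 1. Smoothness of extended exponential sums -/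

/-- The evaluation of a real polynomial is smooth. [folklore] -/
theorem contDiff_polynomial_eval (p : ℝ[X]) {n : WithTop ℕ∞} : ContDiff ℝ n fun u : ℝ => p.eval u := by
  have h : (fun u : ℝ => p.eval u) = fun u => ∑ i ∈ range (p.natDegree + 1), p.coeff i * u ^ i := by
    funext u; exact p.eval_eq_sum_range u
  rw [h]
  exact ContDiff.sum fun i _ => contDiff_const.mul (contDiff_id.pow i)

/-- An extended exponential sum `t ↦ Σ_w P_w(t)e^{u_w t}` (any exponent map `u`) is smooth. [folklore] -/
theorem contDiff_extSum (F : Finset ℝ) (P : ℝ → ℝ[X]) (u : ℝ → ℝ) {n : WithTop ℕ∞} :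
    ContDiff ℝ n (fun s => ∑ w ∈ F, (P w).eval s * Real.exp (u w * s)) := by
  refine ContDiff.sum fun w _ => ?_
  exact (contDiff_polynomial_eval (P w)).mul (Real.contDiff_exp.comp (contDiff_const.mul contDiff_id))

/-! ## 2. The Laguerre–Pólya count WITH MULTIPLICITY -/

/-- **LAGUERRE–PÓLYA COUNT WITH MULTIPLICITY.**  `F` a finite set of real exponents, `P_w` real polynomials, some `P_w ≠ 0` (`w ∈ F`).
If the slot count satisfies `Σ_{w∈F} [P_w ≠ 0]·(natDegree P_w + 1) ≤ N + 1`, then `t ↦ Σ_{w∈F} P_w(t)e^{wt}` has at most `N` real zeros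
COUNTED WITH MULTIPLICITY (`ZerosWithMultiplicityLE … univ N`: every finite set of zeros weighted by orders of vanishing certified through
`iteratedDeriv` has total weight `≤ N`).  Proof: twist by `e^{−w₁t}` at an active exponent (`ZerosWithMultiplicityLE.of_mul`), differentiate
once (`ZerosWithMultiplicityLE.of_deriv`: `Z(F) ≤ Z(F′) + 1` with multiplicity, Pólya–Szegő V.12), observe the slot count drops
(`slots_derivative_lt`, `natDegree_derivative_add_C_mul`), induct; a sum with no active class after differentiation was a non-zero constant.
[folklore: Laguerre 1898; Pólya–Szegő V §75] -/
theorem extSum_zerosWithMultiplicity_le (N : ℕ) :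
    ∀ (F : Finset ℝ) (P : ℝ → ℝ[X]), (∃ w ∈ F, P w ≠ 0) →
      (∑ w ∈ F, if P w = 0 then 0 else (P w).natDegree + 1) ≤ N + 1 →
      ZerosWithMultiplicityLE (fun t => ∑ w ∈ F, (P w).eval t * Real.exp (w * t)) Set.univ N := by
  classical
  induction N with
  | zero =>
    intro F P hne hslots
    obtain ⟨w₁, hw₁F, hw₁⟩ := hne
    -- the single active slot is a non-zero constant: no zeros
    have hsingle : ∑ w ∈ F, (if P w = 0 then 0 else (P w).natDegree + 1) =
        (if P w₁ = 0 then 0 else (P w₁).natDegree + 1) + ∑ w ∈ F.erase w₁, (if P w = 0 then 0 else (P w).natDegree + 1) :=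
      (Finset.add_sum_erase F _ hw₁F).symm
    rw [hsingle, if_neg hw₁] at hslots
    have hdeg : (P w₁).natDegree = 0 := by omega
    have hrest : ∀ w ∈ F.erase w₁, P w = 0 := by
      intro w hw
      by_contra h
      have h1 : (if P w = 0 then 0 else (P w).natDegree + 1) ≤ ∑ w ∈ F.erase w₁, (if P w = 0 then 0 else (P w).natDegree + 1) :=
        Finset.single_le_sum (f := fun w => if P w = 0 then 0 else (P w).natDegree + 1) (fun _ _ => Nat.zero_le _) hw
      rw [if_neg h] at h1
      omega
    obtain ⟨r, hr⟩ := natDegree_eq_zero.1 hdeg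
    have hr0 : r ≠ 0 := by rintro rfl; exact hw₁ (by rw [← hr, C_0])
    refine zerosWithMultiplicityLE_of_ne_zero (fun z _ => ?_) 0
    rw [← Finset.add_sum_erase F _ hw₁F, Finset.sum_eq_zero (fun w hw => by rw [hrest w hw, eval_zero, zero_mul]), add_zero, ← hr, eval_C]
    exact mul_ne_zero hr0 (Real.exp_pos _).ne'
  | succ N ih =>
    intro F P hne hslots
    obtain ⟨w₁, hw₁F, hw₁⟩ := hne
    -- twist at `w₁`: the differentiated data, indexed by the shifted exponents `u = w − w₁`
    set F' : Finset ℝ := F.image (fun w => w - w₁) with hF'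
    set Q : ℝ → ℝ[X] := fun u => derivative (P (u + w₁)) + C u * P (u + w₁) with hQ
    have hinj : Set.InjOn (fun w => w - w₁) F := fun a _ b _ h => by simpa using h
    have hderiv : ∀ t, HasDerivAt (fun s => ∑ w ∈ F, (P w).eval s * Real.exp ((w - w₁) * s))
        (∑ u ∈ F', (Q u).eval t * Real.exp (u * t)) t := by
      intro t
      have h := hasDerivAt_extSum_twist F P w₁ t
      rw [hF', Finset.sum_image hinj]
      convert h using 2
      simp only [hQ, sub_add_cancel]
    have hderiv_eq : deriv (fun s => ∑ w ∈ F, (P w).eval s * Real.exp ((w - w₁) * s))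
        = fun t => ∑ u ∈ F', (Q u).eval t * Real.exp (u * t) := by
      funext t; exact (hderiv t).deriv
    -- slot count of the differentiated data
    have hslots' : ∑ u ∈ F', (if Q u = 0 then 0 else (Q u).natDegree + 1) ≤ N + 1 := by
      rw [hF', Finset.sum_image hinj]
      simp only [hQ, sub_add_cancel]
      have hle : ∀ w ∈ F, (if derivative (P w) + C (w - w₁) * P w = 0 then 0 else (derivative (P w) + C (w - w₁) * P w).natDegree + 1) ≤
          (if P w = 0 then 0 else (P w).natDegree + 1) := by
        intro w _
        by_cases hPw : P w = 0
        · simp [hPw]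
        · rw [if_neg hPw]
          by_cases hww : w = w₁
          · subst hww
            rw [sub_self, C_0, zero_mul, add_zero]
            have := slots_derivative_lt (P w)
            omega
          · obtain ⟨hne0, hdeg⟩ := natDegree_derivative_add_C_mul (P w) hPw (w - w₁) (sub_ne_zero.2 hww)
            rw [if_neg hne0, hdeg]
      have h3 : ∑ w ∈ F.erase w₁, (if derivative (P w) + C (w - w₁) * P w = 0 then 0
          else (derivative (P w) + C (w - w₁) * P w).natDegree + 1) ≤
          ∑ w ∈ F.erase w₁, (if P w = 0 then 0 else (P w).natDegree + 1) :=
        Finset.sum_le_sum fun w hw => hle w (Finset.mem_of_mem_erase hw)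
      have hstrict : (if derivative (P w₁) + C (w₁ - w₁) * P w₁ = 0 then 0 else (derivative (P w₁) + C (w₁ - w₁) * P w₁).natDegree + 1) + 1 ≤
          (if P w₁ = 0 then 0 else (P w₁).natDegree + 1) := by
        rw [sub_self, C_0, zero_mul, add_zero, if_neg hw₁]
        exact slots_derivative_lt (P w₁)
      rw [← Finset.add_sum_erase F _ hw₁F]
      rw [← Finset.add_sum_erase F _ hw₁F] at hslots
      omega
    -- the twisted sum has at most `N + 1` zeros with multiplicity
    have htwist : ZerosWithMultiplicityLE (fun s => ∑ w ∈ F, (P w).eval s * Real.exp ((w - w₁) * s)) Set.univ (N + 1) := by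
      by_cases hact : ∃ u ∈ F', Q u ≠ 0
      · -- differentiate once (Rolle with multiplicity) and induct
        have hih := ih F' Q hact hslots'
        refine ZerosWithMultiplicityLE.of_deriv Set.ordConnected_univ
          (contDiff_extSum F P (fun w => w - w₁) (n := 0)).continuous.continuousOn ?_
        rw [hderiv_eq]
        exact hih
      · -- no active class after differentiation: the twisted sum is a non-zero constant
        push Not at hact
        have hPw : ∀ w ∈ F, w ≠ w₁ → P w = 0 := by
          intro w hw hww
          by_contra h
          have h1 := hact (w - w₁) (Finset.mem_image_of_mem _ hw)
          simp only [hQ, sub_add_cancel] at h1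
          exact (natDegree_derivative_add_C_mul (P w) h (w - w₁) (sub_ne_zero.2 hww)).1 h1
        have hP1 : derivative (P w₁) = 0 := by
          have h1 := hact (w₁ - w₁) (Finset.mem_image_of_mem _ hw₁F)
          simp only [hQ, sub_self, C_0, zero_mul, add_zero, zero_add] at h1
          exact h1
        have hdeg : (P w₁).natDegree = 0 := by
          by_contra hd
          -- `P′ = 0` forces `P` constant over `ℝ`
          exact hd (Polynomial.derivative_eq_zero.mp hP1)
        obtain ⟨r, hr⟩ := natDegree_eq_zero.1 hdeg
        have hr0 : r ≠ 0 := by rintro rfl; exact hw₁ (by rw [← hr, C_0])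
        refine zerosWithMultiplicityLE_of_ne_zero (fun z _ => ?_) (N + 1)
        rw [← Finset.add_sum_erase F _ hw₁F,
          Finset.sum_eq_zero (fun w hw => by
            rw [hPw w (Finset.mem_of_mem_erase hw) (Finset.ne_of_mem_erase hw), eval_zero, zero_mul]),
          add_zero, ← hr, eval_C, sub_self, zero_mul, Real.exp_zero, mul_one]
        exact hr0
    -- untwist: `Σ P_w e^{(w−w₁)t} = e^{−w₁t} · Σ P_w e^{wt}`
    have heq : (fun s => ∑ w ∈ F, (P w).eval s * Real.exp ((w - w₁) * s))
        = fun s => Real.exp (-(w₁ * s)) * ∑ w ∈ F, (P w).eval s * Real.exp (w * s) := by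
      funext s; exact extSum_twist_eq F P w₁ s
    rw [heq] at htwist
    exact ZerosWithMultiplicityLE.of_mul isOpen_univ (Set.subset_univ _)
      (contDiff_extSum F P id).contDiffOn
      ((Real.contDiff_exp.comp (contDiff_const.mul contDiff_id).neg).contDiffOn) htwist

/-! ## 3. The confluent `(2,6)` determinant as an extended exponential sum; slot count -/

/-- **The confluent determinant is an extended exponential sum with at most `|F| + 6` slots**, `F` = the set of pair sums of the five
exponents: `det(e^{e₀t}(τ + tT) + Σ_k e^{e_{k+1}t} S_k) = Σ_{w ∈ F} P_w(t) e^{wt}` with `deg P_w ≤ 2` on the class of `2e₀`, `≤ 1` on the classes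
`e₀ + e_{k+1}`, `0` elsewhere.  (Existential packaging of the coefficient polynomials; no definition.) [folklore] -/
theorem confluentDet_extSum (e : Fin 5 → ℝ) (τ T : Matrix (Fin 2) (Fin 2) ℝ) (S : Fin 4 → Matrix (Fin 2) (Fin 2) ℝ) :
    ∃ P : ℝ → ℝ[X],
      (∀ t : ℝ, ((Real.exp (e 0 * t)) • (τ + t • T) + ∑ k, (Real.exp (e k.succ * t)) • S k).det
        = ∑ w ∈ (univ : Finset (Fin 5 × Fin 5)).image (fun p => e p.1 + e p.2), (P w).eval t * Real.exp (w * t)) ∧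
      (∀ w, (P w).natDegree ≤ (if w = e 0 + e 0 then 2 else 0) +
        (if w ∈ (univ : Finset (Fin 4)).image (fun k => e 0 + e k.succ) then 1 else 0)) := by
  classical
  -- polynomial letters
  let L : Fin 5 → Matrix (Fin 2) (Fin 2) ℝ[X] :=
    Fin.cases (τ.map C + (X : ℝ[X]) • T.map C) (fun k => (S k).map C)
  have hL0 : ∀ i j, L 0 i j = C (τ i j) + X * C (T i j) := by
    intro i j
    show (Fin.cases (τ.map C + (X : ℝ[X]) • T.map C) (fun k => (S k).map C) (0 : Fin 5) : Matrix (Fin 2) (Fin 2) ℝ[X]) i j = _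
    rw [Fin.cases_zero, Matrix.add_apply, Matrix.smul_apply, Matrix.map_apply, Matrix.map_apply, smul_eq_mul, mul_comm]
  have hLs : ∀ (k : Fin 4) i j, L k.succ i j = C (S k i j) := by
    intro k i j
    show (Fin.cases (τ.map C + (X : ℝ[X]) • T.map C) (fun k => (S k).map C) k.succ : Matrix (Fin 2) (Fin 2) ℝ[X]) i j = _
    rw [Fin.cases_succ, Matrix.map_apply]
  have hdeg : ∀ a i j, (L a i j).natDegree ≤ if a = 0 then 1 else 0 := by
    intro a i j
    refine Fin.cases ?_ (fun k => ?_) a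
    · rw [if_pos rfl, hL0]
      refine (natDegree_add_le _ _).trans ?_
      rw [natDegree_C, Nat.zero_max]
      refine (natDegree_mul_le).trans ?_
      rw [natDegree_C, add_zero]
      exact natDegree_X_le
    · rw [if_neg (Fin.succ_ne_zero k), hLs, natDegree_C]
  have heval : ∀ (i j : Fin 2) (t : ℝ), ((Real.exp (e 0 * t)) • (τ + t • T) + ∑ k, (Real.exp (e k.succ * t)) • S k) i j
      = ∑ a, Real.exp (e a * t) * (L a i j).eval t := by
    intro i j t
    have lhs : ((Real.exp (e 0 * t)) • (τ + t • T) + ∑ k, (Real.exp (e k.succ * t)) • S k) i j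
        = Real.exp (e 0 * t) * (τ i j + t * T i j) + ∑ k, Real.exp (e k.succ * t) * S k i j := by
      rw [Matrix.add_apply, Matrix.smul_apply, Matrix.sum_apply, Matrix.add_apply, Matrix.smul_apply]
      simp only [Matrix.smul_apply, smul_eq_mul]
    rw [lhs, Fin.sum_univ_succ (f := fun a => Real.exp (e a * t) * (L a i j).eval t), hL0]
    have rhs : ∀ k : Fin 4, Real.exp (e k.succ * t) * (L k.succ i j).eval t = Real.exp (e k.succ * t) * S k i j := by
      intro k; rw [hLs, eval_C]
    simp only [rhs, eval_add, eval_mul, eval_C, eval_X]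
  -- the pair terms and the coefficient polynomials
  let term : Fin 5 × Fin 5 → ℝ[X] := fun p => L p.1 0 0 * L p.2 1 1 - L p.1 0 1 * L p.2 1 0
  let F : Finset ℝ := (univ : Finset (Fin 5 × Fin 5)).image (fun p => e p.1 + e p.2)
  let P : ℝ → ℝ[X] := fun w => ∑ p ∈ (univ : Finset (Fin 5 × Fin 5)).filter (fun p => e p.1 + e p.2 = w), term p
  refine ⟨P, fun t => ?_, fun w => ?_⟩
  · -- the determinant, expanded and regrouped by pair-sum values
    rw [Matrix.det_fin_two, heval 0 0 t, heval 1 1 t, heval 0 1 t, heval 1 0 t]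
    have hexp : ∀ p : Fin 5 × Fin 5, Real.exp (e p.1 * t) * Real.exp (e p.2 * t) = Real.exp ((e p.1 + e p.2) * t) := by
      intro p; rw [← Real.exp_add]; ring_nf
    have hpairs : (∑ a, Real.exp (e a * t) * (L a 0 0).eval t) * (∑ a, Real.exp (e a * t) * (L a 1 1).eval t)
        - (∑ a, Real.exp (e a * t) * (L a 0 1).eval t) * (∑ a, Real.exp (e a * t) * (L a 1 0).eval t)
        = ∑ p : Fin 5 × Fin 5, (term p).eval t * Real.exp ((e p.1 + e p.2) * t) := by
      rw [← Finset.univ_product_univ, Finset.sum_product, Finset.sum_mul_sum, Finset.sum_mul_sum, ← Finset.sum_sub_distrib]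
      refine Finset.sum_congr rfl fun a _ => ?_
      rw [← Finset.sum_sub_distrib]
      refine Finset.sum_congr rfl fun b _ => ?_
      simp only [term, eval_sub, eval_mul]
      rw [← hexp (a, b)]
      ring
    rw [hpairs]
    symm
    rw [← Finset.sum_fiberwise_of_maps_to (s := (univ : Finset (Fin 5 × Fin 5))) (t := F) (g := fun p => e p.1 + e p.2)
      (fun p hp => Finset.mem_image_of_mem _ hp)]
    refine Finset.sum_congr rfl fun w _ => ?_
    simp only [P, eval_finsetSum, Finset.sum_mul]
    refine Finset.sum_congr rfl fun p hp => ?_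
    rw [(Finset.mem_filter.mp hp).2]
  · -- degree bound per class
    refine (natDegree_sum_le_of_forall_le _ _ fun p hp => ?_)
    have hw : e p.1 + e p.2 = w := (Finset.mem_filter.mp hp).2
    have h1 := hdeg p.1
    have h2 := hdeg p.2
    have hterm : (term p).natDegree ≤ (if p.1 = 0 then 1 else 0) + (if p.2 = 0 then 1 else 0) := by
      refine (natDegree_sub_le _ _).trans (max_le ?_ ?_)
      · exact natDegree_mul_le.trans (add_le_add (h1 0 0) (h2 1 1))
      · exact natDegree_mul_le.trans (add_le_add (h1 0 1) (h2 1 0))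
    refine hterm.trans ?_
    by_cases hp1 : p.1 = 0 <;> by_cases hp2 : p.2 = 0
    · rw [if_pos hp1, if_pos hp2, if_pos (by rw [← hw, hp1, hp2])]
      omega
    · rw [if_pos hp1, if_neg hp2]
      have : w ∈ (univ : Finset (Fin 4)).image (fun k => e 0 + e k.succ) := by
        obtain ⟨k, hk⟩ := Fin.exists_succ_eq.mpr hp2
        exact Finset.mem_image.mpr ⟨k, Finset.mem_univ _, by rw [← hw, hp1, hk]⟩
      rw [if_pos this]; omega
    · rw [if_neg hp1, if_pos hp2]
      have : w ∈ (univ : Finset (Fin 4)).image (fun k => e 0 + e k.succ) := by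
        obtain ⟨k, hk⟩ := Fin.exists_succ_eq.mpr hp1
        exact Finset.mem_image.mpr ⟨k, Finset.mem_univ _, by rw [← hw, hp2, hk, add_comm]⟩
      rw [if_pos this]; omega
    · rw [if_neg hp1, if_neg hp2]; omega

/-- **Slot count.**  With `F` and `P` as above, `Σ_{w∈F} [P_w ≠ 0](deg P_w + 1) ≤ |F| + 6`. [folklore] -/
theorem confluentDet_slots_le (e : Fin 5 → ℝ) (P : ℝ → ℝ[X])
    (hP : ∀ w, (P w).natDegree ≤ (if w = e 0 + e 0 then 2 else 0) +
      (if w ∈ (univ : Finset (Fin 4)).image (fun k => e 0 + e k.succ) then 1 else 0)) :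
    (∑ w ∈ (univ : Finset (Fin 5 × Fin 5)).image (fun p => e p.1 + e p.2), if P w = 0 then 0 else (P w).natDegree + 1)
      ≤ ((univ : Finset (Fin 5 × Fin 5)).image (fun p => e p.1 + e p.2)).card + 6 := by
  classical
  have h1 : (∑ w ∈ (univ : Finset (Fin 5 × Fin 5)).image (fun p => e p.1 + e p.2), if P w = 0 then 0 else (P w).natDegree + 1)
      ≤ ∑ w ∈ (univ : Finset (Fin 5 × Fin 5)).image (fun p => e p.1 + e p.2),
          (1 + ((if w = e 0 + e 0 then 2 else 0) +
            (if w ∈ (univ : Finset (Fin 4)).image (fun k => e 0 + e k.succ) then 1 else 0))) := by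
    refine Finset.sum_le_sum fun w _ => ?_
    have := hP w
    by_cases h : P w = 0
    · rw [if_pos h]; omega
    · rw [if_neg h]; omega
  refine h1.trans ?_
  rw [Finset.sum_add_distrib, Finset.sum_const, smul_eq_mul, mul_one, Finset.sum_add_distrib]
  have h2 : (∑ w ∈ (univ : Finset (Fin 5 × Fin 5)).image (fun p => e p.1 + e p.2), if w = e 0 + e 0 then 2 else 0) ≤ 2 := by
    rw [Finset.sum_ite_eq']
    by_cases h : e 0 + e 0 ∈ (univ : Finset (Fin 5 × Fin 5)).image (fun p => e p.1 + e p.2)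
    · rw [if_pos h]
    · rw [if_neg h]; omega
  have h3 : (∑ w ∈ (univ : Finset (Fin 5 × Fin 5)).image (fun p => e p.1 + e p.2),
      if w ∈ (univ : Finset (Fin 4)).image (fun k => e 0 + e k.succ) then 1 else 0) ≤ 4 := by
    rw [← Finset.sum_filter, Finset.sum_const, smul_eq_mul, mul_one]
    calc (((univ : Finset (Fin 5 × Fin 5)).image (fun p => e p.1 + e p.2)).filter
            (fun w => w ∈ (univ : Finset (Fin 4)).image (fun k => e 0 + e k.succ))).card
          ≤ ((univ : Finset (Fin 4)).image (fun k => e 0 + e k.succ)).card :=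
            Finset.card_le_card (fun w hw => (Finset.mem_filter.mp hw).2)
      _ ≤ (univ : Finset (Fin 4)).card := Finset.card_image_le
      _ = 4 := by simp
  omega

/-- The set of pair sums of five reals has at most `15` elements, and at most `14` if two distinct canonical pairs have the same sum. [folklore] -/
theorem card_pairSums_five (e : Fin 5 → ℝ) :
    ((univ : Finset (Fin 5 × Fin 5)).image (fun p => e p.1 + e p.2)).card ≤ 15 ∧
    ((∃ a b c d : Fin 5, a ≤ b ∧ c ≤ d ∧ (a, b) ≠ (c, d) ∧ e a + e b = e c + e d) →
      ((univ : Finset (Fin 5 × Fin 5)).image (fun p => e p.1 + e p.2)).card ≤ 14) := by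
  classical
  set Cn : Finset (Fin 5 × Fin 5) := univ.filter (fun p => p.1 ≤ p.2) with hCn
  have hCcard : Cn.card = 15 := by rw [hCn]; decide
  -- every pair sum is the sum of a canonical pair
  have hsub : (univ : Finset (Fin 5 × Fin 5)).image (fun p => e p.1 + e p.2) ⊆ Cn.image (fun p => e p.1 + e p.2) := by
    intro w hw
    obtain ⟨p, -, rfl⟩ := Finset.mem_image.mp hw
    rcases le_total p.1 p.2 with h | h
    · exact Finset.mem_image.mpr ⟨p, Finset.mem_filter.mpr ⟨Finset.mem_univ _, h⟩, rfl⟩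
    · exact Finset.mem_image.mpr ⟨(p.2, p.1), Finset.mem_filter.mpr ⟨Finset.mem_univ _, h⟩, by simp [add_comm]⟩
  refine ⟨?_, ?_⟩
  · calc _ ≤ (Cn.image (fun p => e p.1 + e p.2)).card := Finset.card_le_card hsub
      _ ≤ Cn.card := Finset.card_image_le
      _ = 15 := hCcard
  · rintro ⟨a, b, c, d, hab, hcd, hne, hsum⟩
    have hab' : (a, b) ∈ Cn.erase (c, d) := Finset.mem_erase.mpr ⟨hne, Finset.mem_filter.mpr ⟨Finset.mem_univ _, hab⟩⟩
    have hsub' : Cn.image (fun p => e p.1 + e p.2) ⊆ (Cn.erase (c, d)).image (fun p => e p.1 + e p.2) := by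
      intro w hw
      obtain ⟨q, hq, rfl⟩ := Finset.mem_image.mp hw
      by_cases hqc : q = (c, d)
      · subst hqc
        exact Finset.mem_image.mpr ⟨(a, b), hab', hsum⟩
      · exact Finset.mem_image.mpr ⟨q, Finset.mem_erase.mpr ⟨hqc, hq⟩, rfl⟩
    have hcd' : (c, d) ∈ Cn := Finset.mem_filter.mpr ⟨Finset.mem_univ _, hcd⟩
    calc _ ≤ (Cn.image (fun p => e p.1 + e p.2)).card := Finset.card_le_card hsub
      _ ≤ ((Cn.erase (c, d)).image (fun p => e p.1 + e p.2)).card := Finset.card_le_card hsub'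
      _ ≤ (Cn.erase (c, d)).card := Finset.card_image_le
      _ = 14 := by rw [Finset.card_erase_of_mem hcd', hCcard]
/-! ## 4. Counts for the confluent determinant -/

/-- **Extended count of the confluent determinant from the number of pair-sum classes.**  If `|F| + 6 ≤ N + 1` (`F` = pair sums of `e`) and
the determinant is not identically zero, it has at most `N` real zeros counted with multiplicity. [folklore] -/
theorem confluentDet_zerosWithMultiplicity_le (N : ℕ) (e : Fin 5 → ℝ) (τ T : Matrix (Fin 2) (Fin 2) ℝ) (S : Fin 4 → Matrix (Fin 2) (Fin 2) ℝ)
    (hN : ((univ : Finset (Fin 5 × Fin 5)).image (fun p => e p.1 + e p.2)).card + 6 ≤ N + 1)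
    (hne : ∃ t : ℝ, ((Real.exp (e 0 * t)) • (τ + t • T) + ∑ k, (Real.exp (e k.succ * t)) • S k).det ≠ 0) :
    ZerosWithMultiplicityLE (fun t : ℝ => ((Real.exp (e 0 * t)) • (τ + t • T) + ∑ k, (Real.exp (e k.succ * t)) • S k).det)
      Set.univ N := by
  classical
  obtain ⟨P, hrep, hdegP⟩ := confluentDet_extSum e τ T S
  have hact : ∃ w ∈ (univ : Finset (Fin 5 × Fin 5)).image (fun p => e p.1 + e p.2), P w ≠ 0 := by
    by_contra h
    push Not at h
    obtain ⟨t, ht⟩ := hne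
    exact ht (by rw [hrep t]; exact Finset.sum_eq_zero fun w hw => by rw [h w hw, eval_zero, zero_mul])
  have hslots := confluentDet_slots_le e P hdegP
  rw [show (fun t : ℝ => ((Real.exp (e 0 * t)) • (τ + t • T) + ∑ k, (Real.exp (e k.succ * t)) • S k).det) = _ from funext hrep]
  exact extSum_zerosWithMultiplicity_le N _ P hact (by omega)

/-- **GENERIC EXTENDED COUNT WITH MULTIPLICITY (bound 20).**  A non-identically-zero confluent `(2,6)` determinant has at most `20` real
zeros counted with multiplicity — the bound `Σ(deg+1) − 1 = 21 − 1` that the door `ConfluentDoor26` lowers by one. [folklore] -/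
theorem confluentDet_zerosWithMultiplicity_le_twenty (e : Fin 5 → ℝ) (τ T : Matrix (Fin 2) (Fin 2) ℝ) (S : Fin 4 → Matrix (Fin 2) (Fin 2) ℝ)
    (hne : ∃ t : ℝ, ((Real.exp (e 0 * t)) • (τ + t • T) + ∑ k, (Real.exp (e k.succ * t)) • S k).det ≠ 0) :
    ZerosWithMultiplicityLE (fun t : ℝ => ((Real.exp (e 0 * t)) • (τ + t • T) + ∑ k, (Real.exp (e k.succ * t)) • S k).det)
      Set.univ 20 :=
  confluentDet_zerosWithMultiplicity_le 20 e τ T S (by have := (card_pairSums_five e).1; omega) hne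

/-- **THE CONFLUENT DOOR HOLDS OFF THE 2-SIDON LOCUS OF ITS EXPONENTS.**  If the five exponents carry a coincidence between two distinct
canonical pair sums (`e_a + e_b = e_c + e_d`, `a ≤ b`, `c ≤ d`, `(a,b) ≠ (c,d)`), then a non-identically-zero confluent `(2,6)` determinant has at
most **19** real zeros counted with multiplicity: the conclusion of `ConfluentDoor26` (rev 3, log-currency) holds for such `e` WITHOUT the door
(one value class of the DETERMINANT is merged, `21 → 20` slots).  NOT an exit for `Stmt.weylFaces_wall` (module docstring, HONEST LIMITS). [this work] -/
theorem confluentDet_zerosWithMultiplicity_le_nineteen_of_coincidence (e : Fin 5 → ℝ) (τ T : Matrix (Fin 2) (Fin 2) ℝ)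
    (S : Fin 4 → Matrix (Fin 2) (Fin 2) ℝ)
    (hcoin : ∃ a b c d : Fin 5, a ≤ b ∧ c ≤ d ∧ (a, b) ≠ (c, d) ∧ e a + e b = e c + e d)
    (hne : ∃ t : ℝ, ((Real.exp (e 0 * t)) • (τ + t • T) + ∑ k, (Real.exp (e k.succ * t)) • S k).det ≠ 0) :
    ZerosWithMultiplicityLE (fun t : ℝ => ((Real.exp (e 0 * t)) • (τ + t • T) + ∑ k, (Real.exp (e k.succ * t)) • S k).det)
      Set.univ 19 :=
  confluentDet_zerosWithMultiplicity_le 19 e τ T S (by have := (card_pairSums_five e).2 hcoin; omega) hne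

/-- **The door's conclusion, literally** (the shape `ConfluentDoor26` quantifies): under a pair-sum coincidence of `e`,
`∀ Z m, (∀ z ∈ Z, ∀ j < m z, iteratedDeriv j F z = 0) → Σ_{z∈Z} m z ≤ 19`. [this work] -/
theorem confluentDoor_conclusion_of_coincidence (e : Fin 5 → ℝ) (τ T : Matrix (Fin 2) (Fin 2) ℝ) (S : Fin 4 → Matrix (Fin 2) (Fin 2) ℝ)
    (hcoin : ∃ a b c d : Fin 5, a ≤ b ∧ c ≤ d ∧ (a, b) ≠ (c, d) ∧ e a + e b = e c + e d)
    (hne : ∃ t : ℝ, ((Real.exp (e 0 * t)) • (τ + t • T) + ∑ k, (Real.exp (e k.succ * t)) • S k).det ≠ 0)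
    (Z : Finset ℝ) (m : ℝ → ℕ)
    (hZ : ∀ z ∈ Z, ∀ j < m z,
      iteratedDeriv j (fun t : ℝ => ((Real.exp (e 0 * t)) • (τ + t • T) + ∑ k, (Real.exp (e k.succ * t)) • S k).det) z = 0) :
    ∑ z ∈ Z, m z ≤ 19 :=
  confluentDet_zerosWithMultiplicity_le_nineteen_of_coincidence e τ T S hcoin hne Z m (fun z hz => ⟨Set.mem_univ _, hZ z hz⟩)

end Summit.ValiantsHypothesis.ValiantsHypothesis.Theorems.LacunarySymmetroidMatrixDescartes.WallBubbling.Bubbling
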